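import Summits.Ventures.YMGap.RobustBall.RobustAreaLawBall
import Literature.Probability.LatticeModels.DobrushinMetricWeightedDecay
import HarnessLib

/-!
# Robust ball (Y2), area-law side — the WEIGHTED robust slab door (tier 2: no range cut-off)

HONEST FRAMING: venture file of the cell `pub-ymgap` (QuantumFields programme), track ROBUST-BALL (ds-4).  The robust slab door of
`RobustSlabDoor` / `RobustSlabDoorClustering` (rb-p2: Dobrushin's condition in Kantorovich–Rubinstein form for the PERTURBED slab
specification `slabSpecW`, then covariance decay along an `ℕ`-profile of the FINITE-RANGE neighbourhoods) re-run under FÖLLMER'S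
WEIGHTED ROW-SUM CONDITION (LNM 1362, Ch. I, Cor. (2.14)/(2.24); Georgii Remark 8.26; Künsch 1982), through the landed engine
`DobrushinMetric.abs_covariance_le_of_isKRContraction_exp_dist`: the neighbourhoods `nbrW x̄` may be ALL other slice sites (a
perturbation of unbounded range), and the decay rate comes from the WEIGHT `e^{τ · d_graph(x̄,ȳ)}` of the rows, not from a range:
* `slab_weighted_rowsum_le_affine` / `slabW_weighted_rowsum_le` — the weighted row sum of AFFINE influence coefficients
  `A m(x̄,ȳ) + B Λ(x̄,ȳ)` (one-link-modulus door: `A = K e^δ (1 + 2√N ℓ) |β|`, `B = √N`; pair door: `A = e^δ√(cv)|β|`, `B = √(e^δ c)`):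
  `≤ e^{τ}·2n·A + B Λ_τ` when the weighted cross rows are `∑_ȳ Λ(x̄,ȳ) e^{τ d(x̄,ȳ)} ≤ Λ_τ` (plaquette neighbours of the slice are at
  graph distance `≤ 1`);
* `slab_covariance_le_of_isKRContraction_weighted` / `slab_covariance_le_W_weighted` — for EVERY rest `r`:
  `|Cov_{slabLawW}(f, g)| ≤ 2(2√N)² δg δf e^{-τ d(x̄,ȳ)}` for single-site observables at `x̄, ȳ`, as soon as that weighted row sum is
  `≤ c < 1` (generic affine contraction, resp. the one-link-modulus contraction `isKRContraction_slabSpecW`);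
* `slabLawW_entry_cov_le_of_isKRContraction_weighted` / `slabLawW_entry_cov_le_weighted` — the same for the matrix-entry observables
  `φ(Q_x̄)_{ij}`, `ψ(Q_ȳ⁻¹)_{kl}` (`φ, ψ ∈ {Re, Im}`): `|Cov| ≤ 8N e^{-τ d(x̄,ȳ)}` — exactly the hypothesis `hcov` of rb-p2's
  `robust_slab_criterion` with `(C₁, C₂) = (8N, τ)`, uniformly in the rest, the boundary fields, the height, the direction and `L`
  (degenerate slice `L = 1` included).
Abstract in the perturbation `W : GaugeConfig → ℝ` (bounded measurable) and its per-site loads; the loads of a member of rb-theory's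
tier-2 ball `ClusterDomain κ ε₀ ε₁` are read off in `RobustAreaLawBallW`.  Strong-coupling finite-lattice statement; nothing about the
continuum, a mass gap, or Clay.
-/

noncomputable section

open MeasureTheory ProbabilityTheory
open scoped Matrix
open Literature.Probability.LatticeModels hiding glue
open Literature.Probability.LatticeModels.DobrushinMetric
open Literature.MathematicalPhysics.QuantumLattice (fundamentalRep continuous_fundamentalRep fundamentalRep_apply)
open Literature.MathematicalPhysics.QuantumFieldTheory
open Literature.MathematicalPhysics.QuantumFieldTheory.DurhuusFrohlich
open Literature.MathematicalPhysics.QuantumFieldTheory.Balaban1983to89.StrongCouplingDobrushinWindow (OneLinkKRModulus)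

namespace Summit.Ventures.YMGap.RobustBall

variable {n L N : ℕ} [NeZero L] {W : GaugeConfig (n + 1) L (SU N) → ℝ}

/-! ### Weighted row sums of affine slab influence coefficients -/

section Rows

/-- **Weighted row sums of AFFINE slab influence coefficients** (`τ ≥ 0`, `A, B ≥ 0`): if the weighted cross-Lipschitz rows are
`∑_{ȳ ∈ nbr x̄} Λ(x̄,ȳ) e^{τ d(x̄,ȳ)} ≤ Λ_τ`, then `∑_{ȳ ∈ nbr x̄} (A m(x̄,ȳ) + B Λ(x̄,ȳ)) e^{τ d(x̄,ȳ)} ≤ e^{τ}·2n·A + B Λ_τ` — the Wilson part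
lives on the plaquette neighbours `slabNbr x̄` (graph distance `≤ 1`, influence-count row `≤ 2n`), the perturbation part carries its own
weight.  Both the one-link-modulus door (`A = K e^δ(1 + 2√N ℓ)|β|`, `B = √N`) and the Poincaré × variance pair door
(`A = e^δ √(cv) |β|`, `B = √(e^δ c)`) have this shape. [cite: Follmer1988, Ch. I Corollary (2.14)] -/
theorem slab_weighted_rowsum_le_affine (x : TorusSite n L) {A B Λt τ : ℝ} (hA : 0 ≤ A) (hB : 0 ≤ B) (hτ : 0 ≤ τ)
    (nbrW : TorusSite n L → Finset (TorusSite n L)) (Λ : TorusSite n L → TorusSite n L → ℝ)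
    (hroww : ∑ y ∈ Slab.slabNbr x ∪ nbrW x, Λ x y * Real.exp (τ * torusGraphDist x y) ≤ Λt) :
    ∑ y ∈ Slab.slabNbr x ∪ nbrW x, (A * (Slab.slabInfluence x y : ℝ) + B * Λ x y) * Real.exp (τ * torusGraphDist x y) ≤
      Real.exp τ * (2 * (n : ℝ)) * A + B * Λt := by
  classical
  have hsplit : ∀ y ∈ Slab.slabNbr x ∪ nbrW x,
      (A * (Slab.slabInfluence x y : ℝ) + B * Λ x y) * Real.exp (τ * torusGraphDist x y) =
        A * ((Slab.slabInfluence x y : ℝ) * Real.exp (τ * torusGraphDist x y)) + B * (Λ x y * Real.exp (τ * torusGraphDist x y)) :=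
    fun y _ => by ring
  rw [Finset.sum_congr rfl hsplit, Finset.sum_add_distrib, ← Finset.mul_sum, ← Finset.mul_sum]
  refine add_le_add ?_ (mul_le_mul_of_nonneg_left hroww hB)
  -- Wilson part: `m(x̄,ȳ) e^{τ d} ≤ e^{τ} m(x̄,ȳ)` (zero off `slabNbr x̄`, distance `≤ 1` on it), row `≤ 2n`
  have hterm : ∀ y ∈ Slab.slabNbr x ∪ nbrW x,
      (Slab.slabInfluence x y : ℝ) * Real.exp (τ * torusGraphDist x y) ≤ Real.exp τ * Slab.slabInfluence x y := by
    intro y _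
    by_cases hy : y ∈ Slab.slabNbr x
    · rw [mul_comm]
      refine mul_le_mul_of_nonneg_right (Real.exp_le_exp.2 ?_) (Nat.cast_nonneg _)
      calc τ * (torusGraphDist x y : ℝ) ≤ τ * 1 :=
            mul_le_mul_of_nonneg_left (by exact_mod_cast torusGraphDist_le_one_of_mem_slabNbr hy) hτ
        _ = τ := mul_one τ
    · rw [slabInfluence_eq_zero_of_not_mem hy]
      simp
  have hinfl : ∑ y ∈ Slab.slabNbr x ∪ nbrW x, (Slab.slabInfluence x y : ℝ) ≤ 2 * (n : ℝ) := by
    rw [← Finset.sum_subset Finset.subset_union_left fun y _ hy => by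
      rw [slabInfluence_eq_zero_of_not_mem hy, Nat.cast_zero]]
    exact_mod_cast Slab.sum_slabInfluence_le x
  calc A * ∑ y ∈ Slab.slabNbr x ∪ nbrW x, (Slab.slabInfluence x y : ℝ) * Real.exp (τ * torusGraphDist x y)
      ≤ A * (Real.exp τ * (2 * (n : ℝ))) := by
        refine mul_le_mul_of_nonneg_left ?_ hA
        refine (Finset.sum_le_sum hterm).trans ?_
        rw [← Finset.mul_sum]
        exact mul_le_mul_of_nonneg_left hinfl (Real.exp_pos _).le
    _ = Real.exp τ * (2 * (n : ℝ)) * A := by ring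

/-- **Weighted row sums of the one-link-modulus slab influence coefficients** `C(x̄,ȳ) = K e^δ (1 + 2√N ℓ) |β| m(x̄,ȳ) + √N Λ(x̄,ȳ)`
(`τ ≥ 0`): `≤ e^{τ}·e^δ(1 + 2√N ℓ)·2n|β|K + √N Λ_τ` when the weighted cross rows are `≤ Λ_τ`. [cite: Follmer1988, Ch. I Corollary (2.14)] -/
theorem slabW_weighted_rowsum_le (x : TorusSite n L) {β K δ ℓ Λt τ : ℝ} (hK : 0 ≤ K) (hℓ : 0 ≤ ℓ) (hτ : 0 ≤ τ)
    (nbrW : TorusSite n L → Finset (TorusSite n L)) (Λ : TorusSite n L → TorusSite n L → ℝ)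
    (hroww : ∑ y ∈ Slab.slabNbr x ∪ nbrW x, Λ x y * Real.exp (τ * torusGraphDist x y) ≤ Λt) :
    ∑ y ∈ Slab.slabNbr x ∪ nbrW x,
        (K * Real.exp δ * (1 + 2 * Real.sqrt N * ℓ) * |β| * (Slab.slabInfluence x y : ℝ) + Real.sqrt N * Λ x y) *
          Real.exp (τ * torusGraphDist x y) ≤
      Real.exp τ * (Real.exp δ * (1 + 2 * Real.sqrt N * ℓ) * (2 * (n : ℝ) * |β| * K)) + Real.sqrt N * Λt := by
  have h := slab_weighted_rowsum_le_affine x (A := K * Real.exp δ * (1 + 2 * Real.sqrt N * ℓ) * |β|) (B := Real.sqrt N)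
    (by positivity) (Real.sqrt_nonneg _) hτ nbrW Λ hroww
  calc _ ≤ Real.exp τ * (2 * (n : ℝ)) * (K * Real.exp δ * (1 + 2 * Real.sqrt N * ℓ) * |β|) + Real.sqrt N * Λt := h
    _ = _ := by ring

end Rows

/-! ### The weighted robust slab door: generic affine coefficients -/

section Generic

/-- **WEIGHTED SLAB DOOR FROM ANY AFFINE KR CONTRACTION** — Föllmer's `κ̄ < 1` for the perturbed slab specification.  If `slabSpecW v t β W r`
is a Kantorovich–Rubinstein contraction on the neighbourhoods `slabNbr x̄ ∪ nbrW x̄` with AFFINE coefficients `A m(x̄,ȳ) + B Λ(x̄,ȳ)`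
(`A, B, Λ ≥ 0`; the one-link step may be the one-link-modulus transfer or the Poincaré × variance pair), the weighted cross rows are
`∑_ȳ Λ(x̄,ȳ) e^{τ d(x̄,ȳ)} ≤ Λ_τ` (`τ ≥ 0`) and `e^{τ}·2n·A + B Λ_τ ≤ c < 1`, then for EVERY rest `r` and all bounded measurable single-site
observables `f, g` at `x̄, ȳ` with Frobenius-Lipschitz constants `δf, δg`:
`|Cov_{slabLawW}(f, g)| ≤ 2(2√N)² δg δf e^{-τ d(x̄,ȳ)}`, `d` the graph distance of the slice torus — the sets `nbrW x̄` may be ALL other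
sites; the rate comes from the weight. [cite: Follmer1988, Ch. I Corollary (2.14)] -/
theorem slab_covariance_le_of_isKRContraction_weighted (v : Fin (n + 1)) (t : ZMod L) {β A B Λt τ c : ℝ}
    (hA : 0 ≤ A) (hB : 0 ≤ B) (hWm : Measurable W) (hWb : ∃ C, ∀ U, |W U| ≤ C)
    (r : {e : Edge (n + 1) L // ¬ IsSlab v t e} → SU N) (nbrW : TorusSite n L → Finset (TorusSite n L))
    (Λ : TorusSite n L → TorusSite n L → ℝ) (hΛ0 : ∀ x y, 0 ≤ Λ x y)
    (hKR : IsKRContraction (slabSpecW v t β W r) suFrobDist (fun x => Slab.slabNbr x ∪ nbrW x)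
      (fun x y => A * (Slab.slabInfluence x y : ℝ) + B * Λ x y))
    (hτ : 0 ≤ τ) (hroww : ∀ x, ∑ y ∈ Slab.slabNbr x ∪ nbrW x, Λ x y * Real.exp (τ * torusGraphDist x y) ≤ Λt)
    (hc : Real.exp τ * (2 * (n : ℝ)) * A + B * Λt ≤ c) (hc1 : c < 1) (x y : TorusSite n L)
    {f g : (TorusSite n L → SU N) → ℝ} (hfm : Measurable f) (hfdep : DependsOn f ({x} : Set (TorusSite n L)))
    {Mf : ℝ} (hMf : ∀ σ, |f σ| ≤ Mf) {δf : ℝ} (hδf : IsLipBound suFrobDist f fun z => if z = x then δf else 0)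
    (hgm : Measurable g) (hgdep : DependsOn g ({y} : Set (TorusSite n L))) {Mg : ℝ} (hMg : ∀ σ, |g σ| ≤ Mg)
    {δg : ℝ} (hδg : IsLipBound suFrobDist g fun z => if z = y then δg else 0) :
    |cov[f, g; slabLawW v t β W r]| ≤
      2 * (2 * Real.sqrt N) ^ 2 * δg * δf * Real.exp (-(τ * torusGraphDist x y)) := by
  classical
  have hγ := isSpecification_slabSpecW (n := n) (L := L) v t β hWm hWb r
  have hΛt : 0 ≤ Λt := (Finset.sum_nonneg fun z _ => mul_nonneg (hΛ0 x z) (Real.exp_pos _).le).trans (hroww x)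
  have hc0 : 0 ≤ c := le_trans (by positivity) hc
  have key := abs_covariance_le_of_isKRContraction_exp_dist hγ hKR suFrobDist_nonneg suFrobDist_le (by positivity)
    (isGibbsMeasure_slabLawW v t β hWm hWb r) hfm (Δf := {x}) (by simpa using hfdep) hMf hδf hgm (Δg := {y})
    (by simpa using hgdep) hMg hδg hc0 hc1 (fun a b => (torusGraphDist a b : ℝ)) (fun _ _ _ _ => Nat.cast_nonneg _) hτ
    (fun z _ => (slab_weighted_rowsum_le_affine z hA hB hτ nbrW Λ (hroww z)).trans hc)
    (fun z => (torusGraphDist z y : ℝ)) (fun z hz => by rw [Finset.mem_singleton.1 hz, torusGraphDist_self, Nat.cast_zero])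
    (fun z _ w _ => by rw [add_comm]; exact_mod_cast torusGraphDist_triangle z w y) (m := (torusGraphDist x y : ℝ))
    (fun z hz => by rw [Finset.mem_singleton.1 hz])
  simpa using key

/-- **WEIGHTED SLAB DOOR FROM ANY AFFINE KR CONTRACTION, clustering shape** (= hypothesis `hcov` of `robust_slab_criterion`, constants
`(C₁, C₂) = (8N, τ)`, for one rest `r`): under the hypotheses of `slab_covariance_le_of_isKRContraction_weighted` (the contraction being
supplied for the non-degenerate slices `L ≠ 1`), for all slice sites `x̄, ȳ`, indices and `φ, ψ ∈ {Re, Im}`,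
`|Cov_{slabLawW}(φ(Q_x̄)_{ij}, ψ(Q_ȳ⁻¹)_{kl})| ≤ 8N · e^{-τ d(x̄,ȳ)}` (degenerate slice `L = 1`: one site, `|Cov| ≤ 4 ≤ 8N`).
[cite: Follmer1988, Ch. I Corollary (2.14)] [cite: CaoNissimSheffield2025dynamical, Theorem 2.3] -/
theorem slabLawW_entry_cov_le_of_isKRContraction_weighted (hN : 1 ≤ N) (v : Fin (n + 1)) (t : ZMod L) {β A B Λt τ c : ℝ}
    (hA : 0 ≤ A) (hB : 0 ≤ B) (hWm : Measurable W) (hWb : ∃ C, ∀ U, |W U| ≤ C)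
    (r : {e : Edge (n + 1) L // ¬ IsSlab v t e} → SU N) (nbrW : TorusSite n L → Finset (TorusSite n L))
    (Λ : TorusSite n L → TorusSite n L → ℝ) (hΛ0 : ∀ x y, 0 ≤ Λ x y)
    (hKR : L ≠ 1 → IsKRContraction (slabSpecW v t β W r) suFrobDist (fun x => Slab.slabNbr x ∪ nbrW x)
      (fun x y => A * (Slab.slabInfluence x y : ℝ) + B * Λ x y))
    (hτ : 0 ≤ τ) (hroww : ∀ x, ∑ y ∈ Slab.slabNbr x ∪ nbrW x, Λ x y * Real.exp (τ * torusGraphDist x y) ≤ Λt)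
    (hc : Real.exp τ * (2 * (n : ℝ)) * A + B * Λt ≤ c) (hc1 : c < 1)
    (x y : TorusSite n L) (i j k l : Fin N) (φ ψ : ℂ → ℝ)
    (hφ : φ = Complex.re ∨ φ = Complex.im) (hψ : ψ = Complex.re ∨ ψ = Complex.im) :
    |cov[fun Q => φ ((Q x : Matrix (Fin N) (Fin N) ℂ) i j),
        fun Q => ψ ((((Q y)⁻¹ : Matrix.specialUnitaryGroup (Fin N) ℂ) : Matrix (Fin N) (Fin N) ℂ) k l);
        slabLawW v t β W r]| ≤
      8 * N * Real.exp (-τ * torusGraphDist x y) := by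
  classical
  haveI := isProbabilityMeasure_slabLawW (n := n) (L := L) (N := N) v t β hWm hWb r
  obtain ⟨hfm, hfdep, hf1, hfL⟩ := Slab.entryObs_props (n := n) (L := L) x i j hφ
  obtain ⟨hgm, hgdep, hg1, hgL⟩ := Slab.invEntryObs_props (n := n) (L := L) y k l hψ
  have hN8 : (2 : ℝ) * (2 * Real.sqrt N) ^ 2 = 8 * N := by
    rw [mul_pow, Real.sq_sqrt (Nat.cast_nonneg N)]; ring
  have hNr : (1 : ℝ) ≤ N := by exact_mod_cast hN
  by_cases hL1 : L = 1
  · -- degenerate slice: one site, crude bound `|cov| ≤ 4 ≤ 8N`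
    subst hL1
    have hxy : x = y := Subsingleton.elim _ _
    subst hxy
    have h4 := Slab.abs_cov_le_of_abs_le (μ := slabLawW v t β W r) hf1 hg1
    rw [torusGraphDist_self, Nat.cast_zero, mul_zero, Real.exp_zero, mul_one]
    calc _ ≤ 2 * 1 * (2 * 1) := h4
      _ ≤ 8 * N := by nlinarith
  · have key := slab_covariance_le_of_isKRContraction_weighted v t hA hB hWm hWb r nbrW Λ hΛ0 (hKR hL1) hτ hroww hc hc1 x y
      hfm hfdep hf1 hfL hgm hgdep hg1 hgL
    calc _ ≤ 2 * (2 * Real.sqrt N) ^ 2 * 1 * 1 * Real.exp (-(τ * torusGraphDist x y)) := key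
      _ = 8 * N * Real.exp (-τ * torusGraphDist x y) := by rw [← hN8, neg_mul]; ring

end Generic

/-! ### The weighted robust slab door fed by a one-link modulus -/

section Door

/-- **WEIGHTED ROBUST SLAB DOOR (covariance form), one-link-modulus engine** — Föllmer's `κ̄ < 1` for the perturbed slab specification.
Under the hypotheses of `isKRContraction_slabSpecW` (one-link modulus `OneLinkKRModulus N R K` on the slab ball `R ≥ 2n|β|`, neighbourhoods
`nbrW x̄ ∌ x̄` carrying the boundary dependence of the site re-weightings — possibly ALL other sites —, per-site loads `δ, ℓ, Λ(x̄,ȳ)` of the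
re-weighting) and the WEIGHTED row condition `e^{τ}·e^δ(1 + 2√N ℓ)·2n|β|K + √N Λ_τ ≤ c < 1` (`τ ≥ 0`, `∑_ȳ Λ(x̄,ȳ) e^{τ d(x̄,ȳ)} ≤ Λ_τ`), for
EVERY rest `r` and all bounded measurable single-site observables `f, g` at `x̄, ȳ` with Frobenius-Lipschitz constants `δf, δg`:
`|Cov_{slabLawW}(f, g)| ≤ 2(2√N)² δg δf e^{-τ d(x̄,ȳ)}` — no dependence on `r`, `L`, the boundary fields.
[cite: Follmer1988, Ch. I Corollary (2.14)] [cite: CaoNissimSheffield2025dynamical, Def. 2.1 and Thm. 2.3] -/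
theorem slab_covariance_le_W_weighted (hN : 1 ≤ N) (hL1 : L ≠ 1) (v : Fin (n + 1)) (t : ZMod L)
    {β R K δ ℓ Λt τ c : ℝ} (hK : 0 ≤ K) (hℓ : 0 ≤ ℓ) (hR : |β| * (2 * (n : ℝ)) ≤ R) (hmod : OneLinkKRModulus N R K)
    (hWm : Measurable W) (hWb : ∃ C, ∀ U, |W U| ≤ C) (r : {e : Edge (n + 1) L // ¬ IsSlab v t e} → SU N)
    (nbrW : TorusSite n L → Finset (TorusSite n L)) (hnotW : ∀ x, x ∉ nbrW x)
    (hdep : ∀ x (η η' : TorusSite n L → SU N), (∀ z ∈ Slab.slabNbr x ∪ nbrW x, η z = η' z) →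
      ∃ c : ℝ, ∀ g, siteTiltW v t W r x η g = c + siteTiltW v t W r x η' g)
    (hδ : ∀ x ω g g', siteTiltW v t W r x ω g - siteTiltW v t W r x ω g' ≤ δ)
    (hℓ' : ∀ x ω g g', |siteTiltW v t W r x ω g - siteTiltW v t W r x ω g'| ≤ ℓ * suFrobDist g g')
    (Λ : TorusSite n L → TorusSite n L → ℝ) (hΛ0 : ∀ x y, 0 ≤ Λ x y)
    (hΛ : ∀ x y (ω η : TorusSite n L → SU N), (∀ z, z ≠ y → ω z = η z) → ∃ c : ℝ, ∀ g,
      |siteTiltW v t W r x ω g - (c + siteTiltW v t W r x η g)| ≤ Λ x y * suFrobDist (ω y) (η y))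
    (hτ : 0 ≤ τ) (hroww : ∀ x, ∑ y ∈ Slab.slabNbr x ∪ nbrW x, Λ x y * Real.exp (τ * torusGraphDist x y) ≤ Λt)
    (hc : Real.exp τ * (Real.exp δ * (1 + 2 * Real.sqrt N * ℓ) * (2 * (n : ℝ) * |β| * K)) + Real.sqrt N * Λt ≤ c)
    (hc1 : c < 1) (x y : TorusSite n L)
    {f g : (TorusSite n L → SU N) → ℝ} (hfm : Measurable f) (hfdep : DependsOn f ({x} : Set (TorusSite n L)))
    {Mf : ℝ} (hMf : ∀ σ, |f σ| ≤ Mf) {δf : ℝ} (hδf : IsLipBound suFrobDist f fun z => if z = x then δf else 0)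
    (hgm : Measurable g) (hgdep : DependsOn g ({y} : Set (TorusSite n L))) {Mg : ℝ} (hMg : ∀ σ, |g σ| ≤ Mg)
    {δg : ℝ} (hδg : IsLipBound suFrobDist g fun z => if z = y then δg else 0) :
    |cov[f, g; slabLawW v t β W r]| ≤
      2 * (2 * Real.sqrt N) ^ 2 * δg * δf * Real.exp (-(τ * torusGraphDist x y)) := by
  have hKR := isKRContraction_slabSpecW hN hL1 v t hK hℓ hR hmod hWm hWb r nbrW hnotW hdep hδ hℓ' Λ hΛ0 hΛ
  have hKR' : IsKRContraction (slabSpecW v t β W r) suFrobDist (fun x => Slab.slabNbr x ∪ nbrW x)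
      (fun x y => K * Real.exp δ * (1 + 2 * Real.sqrt N * ℓ) * |β| * (Slab.slabInfluence x y : ℝ) + Real.sqrt N * Λ x y) := hKR
  refine slab_covariance_le_of_isKRContraction_weighted v t (A := K * Real.exp δ * (1 + 2 * Real.sqrt N * ℓ) * |β|)
    (B := Real.sqrt N) (by positivity) (Real.sqrt_nonneg _) hWm hWb r nbrW Λ hΛ0 hKR' hτ hroww ?_ hc1 x y hfm hfdep hMf hδf
    hgm hgdep hMg hδg
  calc Real.exp τ * (2 * (n : ℝ)) * (K * Real.exp δ * (1 + 2 * Real.sqrt N * ℓ) * |β|) + Real.sqrt N * Λt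
      = Real.exp τ * (Real.exp δ * (1 + 2 * Real.sqrt N * ℓ) * (2 * (n : ℝ) * |β| * K)) + Real.sqrt N * Λt := by ring
    _ ≤ c := hc

/-- **THE WEIGHTED ROBUST SLAB DOOR IN CLUSTERING SHAPE, one-link-modulus engine** (= hypothesis `hcov` of `robust_slab_criterion`,
constants `(C₁, C₂) = (8N, τ)`, for one rest `r`).  Under the hypotheses of `slab_covariance_le_W_weighted`: for all slice sites `x̄, ȳ`,
indices and `φ, ψ ∈ {Re, Im}`, `|Cov_{slabLawW}(φ(Q_x̄)_{ij}, ψ(Q_ȳ⁻¹)_{kl})| ≤ 8N · e^{-τ d(x̄,ȳ)}` — independent of the rest, the boundary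
fields, the height and `L` (degenerate slice `L = 1` included). [cite: Follmer1988, Ch. I Corollary (2.14)]
[cite: CaoNissimSheffield2025dynamical, Theorem 2.3] -/
theorem slabLawW_entry_cov_le_weighted (hN : 1 ≤ N) (v : Fin (n + 1)) (t : ZMod L)
    {β R K δ ℓ Λt τ c : ℝ} (hK : 0 ≤ K) (hℓ : 0 ≤ ℓ) (hR : |β| * (2 * (n : ℝ)) ≤ R) (hmod : OneLinkKRModulus N R K)
    (hWm : Measurable W) (hWb : ∃ C, ∀ U, |W U| ≤ C) (r : {e : Edge (n + 1) L // ¬ IsSlab v t e} → SU N)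
    (nbrW : TorusSite n L → Finset (TorusSite n L)) (hnotW : ∀ x, x ∉ nbrW x)
    (hdep : ∀ x (η η' : TorusSite n L → SU N), (∀ z ∈ Slab.slabNbr x ∪ nbrW x, η z = η' z) →
      ∃ c : ℝ, ∀ g, siteTiltW v t W r x η g = c + siteTiltW v t W r x η' g)
    (hδ : ∀ x ω g g', siteTiltW v t W r x ω g - siteTiltW v t W r x ω g' ≤ δ)
    (hℓ' : ∀ x ω g g', |siteTiltW v t W r x ω g - siteTiltW v t W r x ω g'| ≤ ℓ * suFrobDist g g')
    (Λ : TorusSite n L → TorusSite n L → ℝ) (hΛ0 : ∀ x y, 0 ≤ Λ x y)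
    (hΛ : ∀ x y (ω η : TorusSite n L → SU N), (∀ z, z ≠ y → ω z = η z) → ∃ c : ℝ, ∀ g,
      |siteTiltW v t W r x ω g - (c + siteTiltW v t W r x η g)| ≤ Λ x y * suFrobDist (ω y) (η y))
    (hτ : 0 ≤ τ) (hroww : ∀ x, ∑ y ∈ Slab.slabNbr x ∪ nbrW x, Λ x y * Real.exp (τ * torusGraphDist x y) ≤ Λt)
    (hc : Real.exp τ * (Real.exp δ * (1 + 2 * Real.sqrt N * ℓ) * (2 * (n : ℝ) * |β| * K)) + Real.sqrt N * Λt ≤ c)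
    (hc1 : c < 1) (x y : TorusSite n L) (i j k l : Fin N) (φ ψ : ℂ → ℝ)
    (hφ : φ = Complex.re ∨ φ = Complex.im) (hψ : ψ = Complex.re ∨ ψ = Complex.im) :
    |cov[fun Q => φ ((Q x : Matrix (Fin N) (Fin N) ℂ) i j),
        fun Q => ψ ((((Q y)⁻¹ : Matrix.specialUnitaryGroup (Fin N) ℂ) : Matrix (Fin N) (Fin N) ℂ) k l);
        slabLawW v t β W r]| ≤
      8 * N * Real.exp (-τ * torusGraphDist x y) := by
  refine slabLawW_entry_cov_le_of_isKRContraction_weighted hN v t (A := K * Real.exp δ * (1 + 2 * Real.sqrt N * ℓ) * |β|)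
    (B := Real.sqrt N) (by positivity) (Real.sqrt_nonneg _) hWm hWb r nbrW Λ hΛ0 (fun hL1 => ?_) hτ hroww ?_ hc1 x y i j k l
    φ ψ hφ hψ
  · exact isKRContraction_slabSpecW hN hL1 v t hK hℓ hR hmod hWm hWb r nbrW hnotW hdep hδ hℓ' Λ hΛ0 hΛ
  · calc Real.exp τ * (2 * (n : ℝ)) * (K * Real.exp δ * (1 + 2 * Real.sqrt N * ℓ) * |β|) + Real.sqrt N * Λt
        = Real.exp τ * (Real.exp δ * (1 + 2 * Real.sqrt N * ℓ) * (2 * (n : ℝ) * |β| * K)) + Real.sqrt N * Λt := by ring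
      _ ≤ c := hc

end Door

end Summit.Ventures.YMGap.RobustBall
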